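import Summits.ResolutionOfSingularities.ResolutionOfSingularities.Theorems.FrobeniusClosingSteerFreeStepTelescope
import Literature.RingTheory.Derivation.MvPowerSeriesCoeffwise
import HarnessLib

/-!
# Crux `Steer` (stmt-ResolutionOfSingularities-16345), chain W4.1, hGW3 (G-geom) WORK-MODULO: Lemma F♭_λ, power-series part — the COEFFICIENT
# DERIVATIONS after `M` free steps (`D̃_l F ∈ (ỹ, z̃) + (x^(M·d))`) and the bound `τ⁺(F) ≥ M − 1` for the `p`-basis Jacobian ideal

OURS (campaign `res-hironaka`, rung L ★L-G4, slot W4.1; seat res-L0-w41-stub-2 g6, res-L0-w41-plan-1 RULING 165b «F♭_λ by the same engine … run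
`free_support` on ∂_λ f₀»; spec = res-L0-w41-idea-3 `G-GEOM-DIRECT.md` v1.1 §3 (F♭_λ) + res-L0-w41-tri-1 TRIAGE v6.19 row R-GG («DECOMPOSITION-FREE:
every derivation kills Ψ², ∂_λ commutes with the relabelling ⇒ 𝒥⁺(f₀) ⊆ Q_m + (x^{m(d−1)})»); replaces the role of no printed item; NOT a statement of the
manuscript under review [claim: Hironaka2017, status: under-review]; AI-produced). Theses-free, definition-free. `K` any commutative ring of characteristic `2`
(no perfectness); `D` any derivation of `K` over any base, extended coefficientwise (`Derivation.mvPowerSeriesCoeffwise`, Matsumura 30.5 (2)).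

* `G3Perf.coeffwise_substGenerators` — `D̃` commutes with the substitution `θ` along an injective exponent map;
* `G3Perf.coeffwise_sq`, `G3Perf.coeffwise_X_pow_mul` — `D̃(Ψ²) = 0` (char 2), `D̃(xⁿ·G) = xⁿ·D̃ G`;
* `G3Perf.coeffwise_support_of_substGenerators_eq` — if `θ_M F = Ψ² + x^(M·d)·G` then EVERY monomial `x^a ỹ^b z̃^c` of `D̃ F` has `M·d ≤ a + M(b+c)`;
* `G3Perf.coeffwise_mem_of_substGenerators_eq` — hence `D̃ F ∈ (ỹ, z̃) + (x^(M·d))`;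
* `G3Perf.milnorLengthPlus_ge_of_substGenerators_eq` — **F♭_λ (formal form)**: for a field `K` of characteristic `2` and any family `D_l` of derivations of `K`,
  `M − 1 ≤ τ⁺(F) := ℓ(K⟦X⟧ ⧸ (∂ₓF, ∂_ỹF, ∂_z̃F, D̃_l F)_l)` (`d ≥ 2`, `M ≥ 1`) — the `p`-basis Jacobian ideal of res-L0-w41-stub-3's K1′
  `IsolatedColength.length_quotient_span_jacobian_lt_top_of_isolated`.
[cite: Matsumura1987, Thm. 30.5 (2)] [folklore]
-/

noncomputable section

set_option linter.dupNamespace false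

open MvPowerSeries Literature.AlgebraicGeometry.Resolution Literature.RingTheory.MvPowerSeries Literature.RingTheory.MvPowerSeries.monoidPowerSeries
open Literature.RingTheory.Derivation
open Summit.ResolutionOfSingularities.ResolutionOfSingularities.Theorems.SwitchingDichotomy.ChartMonomialSubst

namespace Summit.ResolutionOfSingularities.ResolutionOfSingularities.Theorems.SwitchingDichotomy.G3Perf

universe u v w

variable {A : Type w} [CommRing A] {K : Type u} [CommRing K] [Algebra A K]

/-- **Coefficient derivations commute with monomial substitutions** along an injective exponent map: `D̃ (F(x^g)) = (D̃ F)(x^g)`. [folklore] -/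
theorem coeffwise_substGenerators {σ ι : Type v} [Finite ι] (D : Derivation A K K) (g : ι → (σ →₀ ℕ)) (hg0 : ∀ i, g i ≠ 0)
    (hinj : Function.Injective (expSum g)) (F : MvPowerSeries ι K) :
    D.mvPowerSeriesCoeffwise (substGenerators (R := K) g hg0 F) = substGenerators (R := K) g hg0 (D.mvPowerSeriesCoeffwise F) := by
  classical
  ext e
  rw [coeff_mvPowerSeriesCoeffwise]
  by_cases he : ∃ d, expSum g d = e
  · obtain ⟨d, rfl⟩ := he
    rw [coeff_substGenerators_expSum g hg0 hinj, coeff_substGenerators_expSum g hg0 hinj, coeff_mvPowerSeriesCoeffwise]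
  · push Not at he
    rw [coeff_substGenerators_eq_zero_of_forall_ne g hg0 F he, coeff_substGenerators_eq_zero_of_forall_ne g hg0 _ he, map_zero]

/-- In characteristic `2` a coefficient derivation kills squares: `D̃(Ψ²) = 0`. [folklore] -/
theorem coeffwise_sq [CharP K 2] {σ : Type v} (D : Derivation A K K) (Ψ : MvPowerSeries σ K) : D.mvPowerSeriesCoeffwise (Ψ ^ 2) = 0 := by
  haveI : CharP (MvPowerSeries σ K) 2 := charP_of_injective_ringHom (C_injective (σ := σ) (R := K)) 2
  rw [sq, Derivation.leibniz, smul_eq_mul, CharTwo.add_self_eq_zero]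

/-- A coefficient derivation commutes with multiplication by a power of a variable: `D̃(xᵢⁿ·G) = xᵢⁿ·D̃ G`. [folklore] -/
theorem coeffwise_X_pow_mul {σ : Type v} (D : Derivation A K K) (i : σ) (n : ℕ) (G : MvPowerSeries σ K) :
    D.mvPowerSeriesCoeffwise (X i ^ n * G) = X i ^ n * D.mvPowerSeriesCoeffwise G := by
  rw [Derivation.leibniz, Derivation.leibniz_pow, mvPowerSeriesCoeffwise_X, smul_zero, smul_zero, smul_zero, smul_eq_mul, add_zero]

variable [CharP K 2]

/-- **Support of the coefficient derivations after `M` free steps.** If `θ_M F = Ψ² + x^(M·d)·G` then `θ_M (D̃ F) = x^(M·d)·D̃ G`, so EVERY monomial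
`x^a ỹ^b z̃^c` of `D̃ F` (odd or even) has `M·d ≤ a + M(b+c)`. [folklore] -/
theorem coeffwise_support_of_substGenerators_eq {M d : ℕ} (D : Derivation A K K) {F Ψ G : MvPowerSeries (Fin 3) K}
    (h : substGenerators (R := K) (fun i : Fin 3 => Finsupp.single i 1 + if i = 0 then 0 else M • Finsupp.single 0 1)
      (chartExp_ne_zero 0 M) F = Ψ ^ 2 + X 0 ^ (M * d) * G) :
    ∀ e : Fin 3 →₀ ℕ, coeff e (D.mvPowerSeriesCoeffwise F) ≠ 0 → M * d ≤ e 0 + M * (e 1 + e 2) := by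
  classical
  intro e hne
  have hθ : substGenerators (R := K) (fun i : Fin 3 => Finsupp.single i 1 + if i = 0 then 0 else M • Finsupp.single 0 1)
      (chartExp_ne_zero 0 M) (D.mvPowerSeriesCoeffwise F) = X 0 ^ (M * d) * D.mvPowerSeriesCoeffwise G := by
    rw [← coeffwise_substGenerators D _ _ (expSum_chart_injective 0 M), h, map_add, coeffwise_sq, zero_add, coeffwise_X_pow_mul]
  by_contra hlt
  rw [not_le] at hlt
  apply hne
  rw [← coeff_freeShift_substGenerators M (D.mvPowerSeriesCoeffwise F) e, hθ]
  exact (X_pow_dvd_iff.mp (dvd_mul_right _ _)) (freeShift M e) (by simpa [freeShift_zero] using hlt)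

/-- Hence `D̃ F ∈ (ỹ, z̃) + (x^(M·d))`. [folklore] -/
theorem coeffwise_mem_of_substGenerators_eq {M d : ℕ} (D : Derivation A K K) {F Ψ G : MvPowerSeries (Fin 3) K}
    (h : substGenerators (R := K) (fun i : Fin 3 => Finsupp.single i 1 + if i = 0 then 0 else M • Finsupp.single 0 1)
      (chartExp_ne_zero 0 M) F = Ψ ^ 2 + X 0 ^ (M * d) * G) :
    D.mvPowerSeriesCoeffwise F ∈ Ideal.span {(X 1 : MvPowerSeries (Fin 3) K), X 2} ⊔ Ideal.span {X 0 ^ (M * d)} := by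
  refine mem_span_X_X_sup_span_X_pow _ _ fun e he1 he2 he0 => ?_
  by_contra hne
  have := coeffwise_support_of_substGenerators_eq D h e hne
  rw [he1, he2] at this
  omega

end Summit.ResolutionOfSingularities.ResolutionOfSingularities.Theorems.SwitchingDichotomy.G3Perf

namespace Summit.ResolutionOfSingularities.ResolutionOfSingularities.Theorems.SwitchingDichotomy.G3Perf

universe u w

variable {A : Type w} [CommRing A] {K : Type u} [Field K] [CharP K 2] [Algebra A K]

/-- **Lemma F♭_λ, formal form.** In `K⟦x, ỹ, z̃⟧` over a field `K` of characteristic `2` (ANY `p`-rank), for any family `D_l` of derivations of `K`: if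
`θ_M F = Ψ² + x^(M·d)·G` (`2 ≤ d`, `1 ≤ M`) then `M − 1 ≤ τ⁺(F) := ℓ(K⟦X⟧ ⧸ (∂ₓF, ∂_ỹF, ∂_z̃F, D̃_l F)_l)` — all generators lie in `(ỹ, z̃) + (x^(M−1))`
(the formal partials by PART 1, the coefficient derivations by `coeffwise_mem_of_substGenerators_eq`) and `ℓ(K⟦X⟧ ⧸ ((ỹ, z̃) + (x^(M−1)))) ≥ M − 1` (PART 2).
[folklore] -/
theorem milnorLengthPlus_ge_of_substGenerators_eq {e M d : ℕ} (Dl : Fin e → Derivation A K K) (hd : 2 ≤ d) (hM : 1 ≤ M)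
    {F Ψ G : MvPowerSeries (Fin 3) K}
    (h : substGenerators (R := K) (fun i : Fin 3 => Finsupp.single i 1 + if i = 0 then 0 else M • Finsupp.single 0 1)
      (chartExp_ne_zero 0 M) F = Ψ ^ 2 + X 0 ^ (M * d) * G) :
    ((M - 1 : ℕ) : ℕ∞) ≤ Module.length (MvPowerSeries (Fin 3) K) (MvPowerSeries (Fin 3) K ⧸
      Ideal.span (Set.range (fun i : Fin 3 => MvPowerSeries.pderiv i F) ∪ Set.range (fun l => (Dl l).mvPowerSeriesCoeffwise F))) := by
  set J : Ideal (MvPowerSeries (Fin 3) K) :=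
    Ideal.span (Set.range (fun i : Fin 3 => MvPowerSeries.pderiv i F) ∪ Set.range (fun l => (Dl l).mvPowerSeriesCoeffwise F)) with hJ
  have hpow : Ideal.span {(X 0 : MvPowerSeries (Fin 3) K) ^ (M * d)} ≤ Ideal.span {X 0 ^ (M - 1)} :=
    Ideal.span_singleton_le_span_singleton.mpr (pow_dvd_pow _ (by
      calc M - 1 ≤ M := Nat.sub_le M 1
        _ = M * 1 := (mul_one M).symm
        _ ≤ M * d := Nat.mul_le_mul_left M (by omega)))
  have hle : J ≤ arcIdeal K (M - 1) := by
    rw [hJ, Ideal.span_le]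
    rintro _ (⟨i, rfl⟩ | ⟨l, rfl⟩)
    · exact pderiv_mem_of_free_support hd hM F (free_support_of_substGenerators_eq h) i
    · exact sup_le_sup_left hpow _ (coeffwise_mem_of_substGenerators_eq (Dl l) h)
  refine (length_quotient_ge (K := K) (M - 1)).trans ?_
  have hle' : J ≤ Submodule.comap (LinearMap.id : MvPowerSeries (Fin 3) K →ₗ[MvPowerSeries (Fin 3) K] MvPowerSeries (Fin 3) K)
      (arcIdeal K (M - 1)) := by rw [Submodule.comap_id]; exact hle
  let q : (MvPowerSeries (Fin 3) K ⧸ J) →ₗ[MvPowerSeries (Fin 3) K] (MvPowerSeries (Fin 3) K ⧸ arcIdeal K (M - 1)) :=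
    Submodule.mapQ _ _ LinearMap.id hle'
  have hq : Function.Surjective q := by
    intro y
    induction y using Submodule.Quotient.induction_on with
    | H a => exact ⟨Submodule.Quotient.mk a, rfl⟩
  exact Module.length_le_of_surjective q hq

end Summit.ResolutionOfSingularities.ResolutionOfSingularities.Theorems.SwitchingDichotomy.G3Perf

end
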